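import Mathlib.Analysis.Asymptotics.SpecificAsymptotics
import Literature.MathematicalPhysics.QuantumLattice.WilsonLoopsProofs
import Literature.RepresentationTheory.CompactGroups.UnitaryTrick
import HarnessLib

/-!
# String tension from reflection-positivity inequalities: the real-analysis layer

Companion of `Literature.MathematicalPhysics.QuantumFieldTheory.LatticeGauge` (named fact
`exists_hasStringTension`, inventory item constructive-qft.S12) and of
`Literature.MathematicalPhysics.QuantumLattice.WilsonLoops` (`HasStaticPotential`,
`HasStringTension`). This file contains the part of the proof of existence of the static
potential `V(R) = -lim_T T⁻¹ log W(R,T)` and of the string tension `σ = lim_R V(R)/R` that is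
pure real analysis, and the passage of the required inequalities from the torus Wilson states to
infinite-volume limit points. Everything here is proved; no definition, no named fact.

## Contents

* `StringTension.tendsto_div_of_concave_nonneg` — if `b : ℕ → ℝ` is non-negative and
  (discretely) concave on `n ≥ 1`, then `b n / n` converges to a limit `V ≥ 0` (the increments
  are non-increasing and, `b` being non-negative, non-negative; Cesàro).
* `StringTension.hasStringTension_of_logConvex` — for a state `μ` on `LGConfig d G` and a class
  function `χ`: if the rectangular Wilson loop expectations `W(R,T)`, `R, T ≥ 1`, are positive,
  bounded by `1`, and log-convex in `T` and in `R`
  (`W(R,T+1)² ≤ W(R,T) W(R,T+2)`, `W(R+1,T)² ≤ W(R,T) W(R+2,T)`), then the static potential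
  exists for every `R ≥ 1`, is non-negative and concave, and the string tension
  `σ = lim V(R)/R ≥ 0` exists (`HasStringTension`).
* `StringTension.hasStringTension_of_eventually` — the same conclusion for an infinite-volume
  limit point `μ ∈ infiniteVolumeLimitPoints ρ β` of the torus Wilson states, from the
  corresponding inequalities for the torus loop expectations `⟨W_{R×T}⟩_{Λ_{L+1},β}` valid for all
  large `L` (they pass to the limit along the defining subsequence of tori by
  `tendsto_wilsonExpectation_wilsonLoop`), the bound `|χ| ≤ 1` and the non-vanishing of the
  limit loop expectations.

The log-convexity inequalities themselves are the content of reflection positivity of the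
Wilson action in lattice hyperplanes and in hyperplanes between lattice planes (Osterwalder–Seiler
1978 §2; Seiler LNP 159 §2): `W(R, T₁+T₂)² ≤ W(R, 2T₁) W(R, 2T₂)` by the Cauchy–Schwarz
inequality of the reflection-positive inner product; they are proved for the torus Wilson states
in the sibling files and are hypotheses here.

## References

* E. Seiler, *Gauge Theories as a Problem of Constructive Quantum Field Theory and Statistical
  Mechanics*, LNP 159 (1982), §2 (static potential and string tension from reflection
  positivity).
* K. Osterwalder, E. Seiler, Ann. Phys. 110 (1978) 440, §2 (reflection positivity).
* S. Chatterjee, *Yang–Mills for probabilists*, arXiv:1803.01950, §4 (`V(R)`, string tension).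
-/

noncomputable section

open MeasureTheory Filter Finset
open scoped Topology

namespace Literature.MathematicalPhysics.QuantumFieldTheory

namespace StringTension

/-! ### Real analysis: non-negative concave sequences -/

/-- Telescoping for a sequence: `b (k + n + 1) = b (k + 1) + ∑_{i < n} (b (k+i+2) - b (k+i+1))`.
[folklore] -/
theorem eq_add_sum_sub (b : ℕ → ℝ) (k n : ℕ) :
    b (k + n + 1) = b (k + 1) + ∑ i ∈ range n, (b (k + i + 2) - b (k + i + 1)) := by
  have h := Finset.sum_range_sub (fun i => b (k + i + 1)) n
  have h' : ∑ i ∈ range n, (b (k + (i + 1) + 1) - b (k + i + 1)) =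
      ∑ i ∈ range n, (b (k + i + 2) - b (k + i + 1)) :=
    Finset.sum_congr rfl fun i _ => by ring_nf
  rw [h'] at h
  rw [h]
  ring_nf

/-- **A non-negative, discretely concave sequence has a linear growth rate.** If `b n ≥ 0` for
`n ≥ 1` and `b n + b (n+2) ≤ 2 b (n+1)` for `n ≥ 1`, then the increments
`b (n+2) - b (n+1)` are non-increasing and non-negative, hence converge to some `V ≥ 0`, and
`b n / n → V` (Cesàro). This is the elementary mechanism by which reflection positivity yields
the static potential and the string tension (Seiler LNP 159 §2). [folklore] -/
theorem tendsto_div_of_concave_nonneg {b : ℕ → ℝ} (h0 : ∀ n, 1 ≤ n → 0 ≤ b n)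
    (hc : ∀ n, 1 ≤ n → b n + b (n + 2) ≤ 2 * b (n + 1)) :
    ∃ V : ℝ, 0 ≤ V ∧ Tendsto (fun n : ℕ => b n / n) atTop (𝓝 V) := by
  -- the increments
  set Δ : ℕ → ℝ := fun n => b (n + 2) - b (n + 1) with hΔ
  have hanti : Antitone Δ := by
    refine antitone_nat_of_succ_le fun n => ?_
    have := hc (n + 1) (by omega)
    simp only [hΔ]
    rw [show n + 1 + 2 = n + 3 by ring, show n + 1 + 1 = n + 2 by ring] at *
    linarith
  -- telescoping from index `k + 1`
  have htel : ∀ k n, b (k + n + 1) = b (k + 1) + ∑ i ∈ range n, Δ (k + i) := fun k n => by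
    rw [eq_add_sum_sub b k n]
  -- the increments are non-negative
  have hnonneg : ∀ k, 0 ≤ Δ k := by
    intro k
    by_contra hneg
    rw [not_le] at hneg
    -- choose `n` with `b (k+1) + n * Δ k < 0`
    obtain ⟨n, hn⟩ := exists_nat_gt (b (k + 1) / (-Δ k))
    have hΔpos : 0 < -Δ k := by linarith
    have hn' : b (k + 1) + n * Δ k < 0 := by
      have := (div_lt_iff₀ hΔpos).1 hn
      linarith
    have hsum : ∑ i ∈ range n, Δ (k + i) ≤ n * Δ k := by
      calc ∑ i ∈ range n, Δ (k + i) ≤ ∑ _i ∈ range n, Δ k :=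
            Finset.sum_le_sum fun i _ => hanti (Nat.le_add_right k i)
        _ = n * Δ k := by rw [Finset.sum_const, Finset.card_range, nsmul_eq_mul]
    have hb := h0 (k + n + 1) (by omega)
    rw [htel k n] at hb
    linarith
  -- the increments converge to their infimum `V ≥ 0`
  have hbdd : BddBelow (Set.range Δ) := ⟨0, by rintro _ ⟨k, rfl⟩; exact hnonneg k⟩
  set V : ℝ := ⨅ k, Δ k with hV
  have hVnonneg : 0 ≤ V := le_ciInf hnonneg
  have hΔlim : Tendsto Δ atTop (𝓝 V) := tendsto_atTop_ciInf hanti hbdd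
  refine ⟨V, hVnonneg, ?_⟩
  -- Cesàro: `b (n+1) / (n+1) = b 1 / (n+1) + (n/(n+1)) · (n⁻¹ ∑_{i<n} Δ i) → V`
  have hces : Tendsto (fun n : ℕ => (n⁻¹ : ℝ) * ∑ i ∈ range n, Δ i) atTop (𝓝 V) := hΔlim.cesaro
  have h1 : Tendsto (fun n : ℕ => b 1 / ((n : ℝ) + 1)) atTop (𝓝 0) := by
    have h := (tendsto_one_div_add_atTop_nhds_zero_nat (𝕜 := ℝ)).const_mul (b 1)
    rw [mul_zero] at h
    refine h.congr fun n => ?_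
    ring
  have h2 : Tendsto (fun n : ℕ => (n : ℝ) / ((n : ℝ) + 1)) atTop (𝓝 1) :=
    tendsto_natCast_div_add_atTop (1 : ℝ)
  have hmain : Tendsto (fun n : ℕ => b (n + 1) / ((n : ℝ) + 1)) atTop (𝓝 V) := by
    have hlim := h1.add (h2.mul hces)
    rw [zero_add, one_mul] at hlim
    refine hlim.congr' ?_
    filter_upwards [eventually_ge_atTop 1] with n hn
    have hn0 : (n : ℝ) ≠ 0 := by exact_mod_cast (show n ≠ 0 by omega)
    have hn1 : (n : ℝ) + 1 ≠ 0 := by positivity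
    have := htel 0 n
    simp only [zero_add] at this
    rw [this]
    field_simp
  refine (tendsto_add_atTop_iff_nat 1).1 ?_
  refine hmain.congr fun n => ?_
  push_cast
  ring_nf

/-! ### From positivity and log-convexity to the string tension -/

section StateLevel

open Literature.MathematicalPhysics.QuantumLattice Literature.Probability.LatticeModels

variable {d : ℕ} {G : Type*} [Group G] [MeasurableSpace G] [NeZero d]

/-- Log-convexity of positive numbers in additive form: `w₁² ≤ w₀ w₂` with `w₀, w₁, w₂ > 0`
gives `-log w₀ + (-log w₂) ≤ 2 (-log w₁)`. [folklore] -/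
theorem neg_log_add_le_of_sq_le_mul {w₀ w₁ w₂ : ℝ} (h₀ : 0 < w₀) (h₁ : 0 < w₁) (h₂ : 0 < w₂)
    (h : w₁ ^ 2 ≤ w₀ * w₂) : -Real.log w₀ + -Real.log w₂ ≤ 2 * -Real.log w₁ := by
  have hlog := Real.log_le_log (pow_pos h₁ 2) h
  rw [Real.log_pow, Real.log_mul h₀.ne' h₂.ne'] at hlog
  push_cast at hlog
  linarith

/-- **Static potential and string tension from positivity and log-convexity** (the
real-analysis half of Seiler LNP 159 §2, Thm. 2.4-type statement). Let `μ` be a state on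
`LGConfig d G` and `χ` a class function such that the rectangular Wilson loop expectations
`W(R,T) = rectExpectation μ χ 0 1 R T`, `R, T ≥ 1`, satisfy: `0 < W(R,T) ≤ 1`, and the two
log-convexities `W(R,T+1)² ≤ W(R,T) W(R,T+2)`, `W(R+1,T)² ≤ W(R,T) W(R+2,T)` (consequences of
reflection positivity in the two lattice directions). Then `-log W(R,T)` is non-negative and
concave in `T`, the static potential `V(R) = lim_T -log W(R,T)/T ≥ 0` exists for every `R ≥ 1`
(`HasStaticPotential`), `V` is concave, and the string tension `σ = lim_R V(R)/R ≥ 0` exists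
(`HasStringTension`). [folklore] -/
theorem hasStringTension_of_logConvex (μ : Measure (LGConfig d G)) (χ : G → ℝ)
    (hpos : ∀ R T, 1 ≤ R → 1 ≤ T → 0 < rectExpectation μ χ 0 1 R T)
    (hle : ∀ R T, 1 ≤ R → 1 ≤ T → rectExpectation μ χ 0 1 R T ≤ 1)
    (hT : ∀ R T, 1 ≤ R → 1 ≤ T →
      rectExpectation μ χ 0 1 R (T + 1) ^ 2 ≤
        rectExpectation μ χ 0 1 R T * rectExpectation μ χ 0 1 R (T + 2))
    (hR : ∀ R T, 1 ≤ R → 1 ≤ T →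
      rectExpectation μ χ 0 1 (R + 1) T ^ 2 ≤
        rectExpectation μ χ 0 1 R T * rectExpectation μ χ 0 1 (R + 2) T) :
    ∃ σ : ℝ, 0 ≤ σ ∧ HasStringTension μ χ σ := by
  set W : ℕ → ℕ → ℝ := fun R T => rectExpectation μ χ 0 1 R T with hW
  set b : ℕ → ℕ → ℝ := fun R T => -Real.log (W R T) with hb
  have hb0 : ∀ R T, 1 ≤ R → 1 ≤ T → 0 ≤ b R T := fun R T hR1 hT1 => by
    simp only [hb]
    have := Real.log_nonpos (hpos R T hR1 hT1).le (hle R T hR1 hT1)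
    linarith
  -- concavity in `T` and the static potential
  have hVex : ∀ R, 1 ≤ R → ∃ V : ℝ, 0 ≤ V ∧ Tendsto (fun T : ℕ => b R T / T) atTop (𝓝 V) := by
    intro R hR1
    refine tendsto_div_of_concave_nonneg (fun T hT1 => hb0 R T hR1 hT1) fun T hT1 => ?_
    exact neg_log_add_le_of_sq_le_mul (hpos R T hR1 hT1) (hpos R (T + 1) hR1 (by omega))
      (hpos R (T + 2) hR1 (by omega)) (hT R T hR1 hT1)
  choose! V hV0 hVlim using hVex
  have hstat : ∀ R, 1 ≤ R → HasStaticPotential μ χ R (V R) := by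
    intro R hR1
    refine ⟨?_, ?_⟩
    · filter_upwards [eventually_ge_atTop 1] with T hT1
      exact (hpos R T hR1 hT1).ne'
    · refine (hVlim R hR1).congr' ?_
      filter_upwards [eventually_ge_atTop 1] with T hT1
      simp only [hb, hW]
      rw [abs_of_pos (hpos R T hR1 hT1)]
  -- concavity of `V`
  have hVconc : ∀ R, 1 ≤ R → V R + V (R + 2) ≤ 2 * V (R + 1) := by
    intro R hR1
    have hlim₁ : Tendsto (fun T : ℕ => b R T / T + b (R + 2) T / T) atTop (𝓝 (V R + V (R + 2))) :=
      (hVlim R hR1).add (hVlim (R + 2) (by omega))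
    have hlim₂ : Tendsto (fun T : ℕ => 2 * (b (R + 1) T / T)) atTop (𝓝 (2 * V (R + 1))) :=
      (hVlim (R + 1) (by omega)).const_mul 2
    refine le_of_tendsto_of_tendsto hlim₁ hlim₂ ?_
    filter_upwards [eventually_ge_atTop 1] with T hT1
    have hTpos : (0 : ℝ) < T := by exact_mod_cast hT1
    have hconc := neg_log_add_le_of_sq_le_mul (hpos R T hR1 hT1) (hpos (R + 1) T (by omega) hT1)
      (hpos (R + 2) T (by omega) hT1) (hR R T hR1 hT1)
    simp only [hb]
    rw [← add_div, mul_div_assoc']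
    exact div_le_div_of_nonneg_right hconc hTpos.le
  obtain ⟨σ, hσ0, hσlim⟩ := tendsto_div_of_concave_nonneg (fun R hR1 => hV0 R hR1) hVconc
  exact ⟨σ, hσ0, V, hstat, hσlim⟩

end StateLevel

/-! ### Passage from the torus Wilson states to limit points -/

section Limits

open Literature.MathematicalPhysics.QuantumLattice Literature.Probability.LatticeModels

variable {d N : ℕ} {G : Type*} [Group G] [TopologicalSpace G] [IsTopologicalGroup G]
  [CompactSpace G] [MeasurableSpace G] [BorelSpace G] (ρ : G →* Matrix (Fin N) (Fin N) ℂ)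

omit [MeasurableSpace G] [BorelSpace G] in
/-- The normalised character of a continuous finite-dimensional representation of a compact
group is bounded by `1` in absolute value (`|Re tr ρ(g)| ≤ N`, unitarian trick;
`Literature.RepresentationTheory.CompactGroups.CompactGroup.abs_re_trace_le_card`). [folklore] -/
theorem abs_normalisedCharacter_le_one (hρ : Continuous ρ) (g : G) :
    |normalisedCharacter N (ρ g)| ≤ 1 := by
  unfold normalisedCharacter
  rcases Nat.eq_zero_or_pos N with hN | hN
  · subst hN; simp
  · have hNpos : (0 : ℝ) < N := by exact_mod_cast hN
    have h := Literature.RepresentationTheory.CompactGroups.CompactGroup.abs_re_trace_le_card ρ hρ g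
    rw [Fintype.card_fin] at h
    rw [abs_mul, abs_inv, abs_of_pos hNpos, inv_mul_le_iff₀ hNpos, mul_one]
    exact h

omit [BorelSpace G] in
/-- Loop expectations of a probability measure are bounded by `1` in absolute value for the
normalised character of a continuous representation. [folklore] -/
theorem abs_rectExpectation_le_one [NeZero d] (hρ : Continuous ρ) (μ : Measure (LGConfig d G))
    [IsProbabilityMeasure μ] (R T : ℕ) :
    |rectExpectation μ (fun g => normalisedCharacter N (ρ g)) 0 1 R T| ≤ 1 := by
  unfold rectExpectation loopExpectation
  have hbd : ∀ U, ‖wilsonLoopObs (fun g => normalisedCharacter N (ρ g))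
      (rectWalk (0 : Literature.Probability.LatticeModels.Site d) 0 1 R T) U‖ ≤ 1 :=
    fun U => by
      rw [Real.norm_eq_abs]
      exact abs_normalisedCharacter_le_one ρ hρ _
  calc |∫ U, wilsonLoopObs (fun g => normalisedCharacter N (ρ g))
          (rectWalk (0 : Literature.Probability.LatticeModels.Site d) 0 1 R T) U ∂μ|
      = ‖∫ U, wilsonLoopObs (fun g => normalisedCharacter N (ρ g))
          (rectWalk (0 : Literature.Probability.LatticeModels.Site d) 0 1 R T) U ∂μ‖ :=
        (Real.norm_eq_abs _).symm
    _ ≤ 1 * μ.real Set.univ := norm_integral_le_of_norm_le_const (Filter.Eventually.of_forall hbd)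
    _ = 1 := by rw [probReal_univ, mul_one]

variable [NeZero d]

/-- **A log-convexity inequality between torus loop expectations, valid on all large tori,
passes to every infinite-volume limit point** (the three loop expectations converge along the
defining subsequence of tori, `tendsto_wilsonExpectation_wilsonLoop`). [folklore] -/
theorem sq_rectExpectation_le_mul_of_eventually (hρ : Continuous ρ) {β : ℝ}
    {μ : Measure (LGConfig d G)} (hμ : μ ∈ infiniteVolumeLimitPoints ρ β)
    {R₁ T₁ R₂ T₂ R₃ T₃ : ℕ}
    (h : ∀ᶠ L : ℕ in atTop,
      wilsonExpectation (L := L + 1) ρ β (wilsonLoop ρ (0 : Site d (L + 1)) 0 1 R₁ T₁) ^ 2 ≤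
        wilsonExpectation (L := L + 1) ρ β (wilsonLoop ρ (0 : Site d (L + 1)) 0 1 R₂ T₂) *
          wilsonExpectation (L := L + 1) ρ β (wilsonLoop ρ (0 : Site d (L + 1)) 0 1 R₃ T₃)) :
    rectExpectation μ (fun g => normalisedCharacter N (ρ g)) 0 1 R₁ T₁ ^ 2 ≤
      rectExpectation μ (fun g => normalisedCharacter N (ρ g)) 0 1 R₂ T₂ *
        rectExpectation μ (fun g => normalisedCharacter N (ρ g)) 0 1 R₃ T₃ := by
  obtain ⟨Ls, hLs, hlim⟩ := hμ
  have h₁ := tendsto_wilsonExpectation_wilsonLoop ρ hρ hlim R₁ T₁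
  have h₂ := tendsto_wilsonExpectation_wilsonLoop ρ hρ hlim R₂ T₂
  have h₃ := tendsto_wilsonExpectation_wilsonLoop ρ hρ hlim R₃ T₃
  exact le_of_tendsto_of_tendsto (h₁.pow 2) (h₂.mul h₃) (hLs.tendsto_atTop.eventually h)

/-- **String tension of a limit state from torus reflection-positivity inequalities.** Let `ρ`
be a continuous matrix representation of the compact group `G`, `d ≥ 1`, and
`μ ∈ infiniteVolumeLimitPoints ρ β`. Suppose that for all `R, T ≥ 1` and all sufficiently large
torus sizes `L + 1` the torus loop expectations `w_L(R,T) = ⟨W_{R×T}⟩_{Λ_{L+1},β}` (rectangle at the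
origin of the `(0,1)` plane) satisfy `0 ≤ w_L(R,T)`, `w_L(R,T+1)² ≤ w_L(R,T) w_L(R,T+2)` and
`w_L(R+1,T)² ≤ w_L(R,T) w_L(R+2,T)`, and that the limit loop expectations `W_μ(R,T)`, `R, T ≥ 1`,
do not vanish. Then `μ` has a non-negative string tension in the sense of `HasStringTension`
(static potentials `V(R) ≥ 0` for all `R ≥ 1` and `V(R)/R → σ ≥ 0`). The torus inequalities are
what reflection positivity of the Wilson action provides (Osterwalder–Seiler 1978 §2; Seiler
LNP 159 §2); this theorem is the model-independent remainder of the argument. [folklore] -/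
theorem hasStringTension_of_eventually (hρ : Continuous ρ) {β : ℝ}
    {μ : Measure (LGConfig d G)} (hμ : μ ∈ infiniteVolumeLimitPoints ρ β)
    (hnonneg : ∀ R T, 1 ≤ R → 1 ≤ T → ∀ᶠ L : ℕ in atTop,
      0 ≤ wilsonExpectation (L := L + 1) ρ β (wilsonLoop ρ (0 : Site d (L + 1)) 0 1 R T))
    (hT : ∀ R T, 1 ≤ R → 1 ≤ T → ∀ᶠ L : ℕ in atTop,
      wilsonExpectation (L := L + 1) ρ β (wilsonLoop ρ (0 : Site d (L + 1)) 0 1 R (T + 1)) ^ 2 ≤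
        wilsonExpectation (L := L + 1) ρ β (wilsonLoop ρ (0 : Site d (L + 1)) 0 1 R T) *
          wilsonExpectation (L := L + 1) ρ β (wilsonLoop ρ (0 : Site d (L + 1)) 0 1 R (T + 2)))
    (hR : ∀ R T, 1 ≤ R → 1 ≤ T → ∀ᶠ L : ℕ in atTop,
      wilsonExpectation (L := L + 1) ρ β (wilsonLoop ρ (0 : Site d (L + 1)) 0 1 (R + 1) T) ^ 2 ≤
        wilsonExpectation (L := L + 1) ρ β (wilsonLoop ρ (0 : Site d (L + 1)) 0 1 R T) *
          wilsonExpectation (L := L + 1) ρ β (wilsonLoop ρ (0 : Site d (L + 1)) 0 1 (R + 2) T))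
    (hW : ∀ R T, 1 ≤ R → 1 ≤ T →
      rectExpectation μ (fun g => normalisedCharacter N (ρ g)) 0 1 R T ≠ 0) :
    ∃ σ : ℝ, 0 ≤ σ ∧ HasStringTension μ (fun g => normalisedCharacter N (ρ g)) σ := by
  haveI : IsProbabilityMeasure μ := by
    obtain ⟨Ls, -, hlim⟩ := hμ
    exact hlim.1
  have hpos : ∀ R T, 1 ≤ R → 1 ≤ T →
      0 < rectExpectation μ (fun g => normalisedCharacter N (ρ g)) 0 1 R T := fun R T hR1 hT1 =>
    lt_of_le_of_ne (le_rectExpectation_of_eventually ρ hρ hμ (hnonneg R T hR1 hT1))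
      (hW R T hR1 hT1).symm
  refine hasStringTension_of_logConvex μ _ hpos (fun R T _ _ => ?_)
    (fun R T hR1 hT1 => sq_rectExpectation_le_mul_of_eventually ρ hρ hμ (hT R T hR1 hT1))
    (fun R T hR1 hT1 => sq_rectExpectation_le_mul_of_eventually ρ hρ hμ (hR R T hR1 hT1))
  exact (le_abs_self _).trans (abs_rectExpectation_le_one ρ hρ μ R T)

end Limits

end StringTension

end Literature.MathematicalPhysics.QuantumFieldTheory
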